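import Literature.NumberTheory.DiophantineGeometry.LocalReductionHasMultiplicativeReductionAtProofs
import Literature.NumberTheory.EllipticCurves.SzpiroLocalDataProofs
import Literature.NumberTheory.EllipticCurves.QuadraticTwistKroneckerLFunctionProofs
import Literature.NumberTheory.EllipticCurves.RootNumberProofs
import Literature.NumberTheory.EllipticCurves.HeightFamily
import HarnessLib

/-!
# Bhargava–Skinner–Zhang, proof of Lemma 17: the reduction type of `E_{A,B}` at a prime `p ≥ 5`

`Proofs` companion of `Literature/NumberTheory/EllipticCurves/LeadingTerm.lean` (bsd.S27,
`Literature.NumberTheory.EllipticCurves.bhargava_skinner_zhang`) and of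
`LeadingTermBSZLocalDensityProofs.lean` (which proves the DENSITY half of Lemma 17,
`hasHeightDensity_not_five_dvd : HasHeightDensity (5 ∤ A) (4·5¹⁰/(5(5¹⁰-1)))`). Source:
M. Bhargava, C. Skinner, W. Zhang, *A majority of elliptic curves over `ℚ` satisfy the Birch and
Swinnerton-Dyer conjecture*, arXiv:1407.1826 (2014), §3.1–§3.2. The family is
`E_{A,B} : y² = x³ + Ax + B`, `(A, B) ∈ ℤ²`, with "`p⁶ ∤ B` whenever `p⁴ ∣ A`" (the tree's
`IsInHeightFamily`, `shortWeierstrass`), and `S₀(p)` is "the set of elliptic curves `E_{A,B}` over `ℚ`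
such that `E_{A,B}` has good ordinary or multiplicative reduction at `p`". The proof of Lemma 17
(p. 8 of the source) reads:

> "Let `p ≥ 5` be a prime. It follows from [Sil] that `E_{A,B}` is a minimal Weierstrass equation
> at `p`. Therefore, `E_{A,B}` has good reduction at `p` if and only if `p ∤ Δ(A,B)` [Sil]. In this
> case, the condition that `E_{A,B}` has ordinary reduction is that `p` not divide the coefficient of
> `x^{p-1}` in `(x³+Ax+B)^{(p-1)/2}` [Sil]. Similarly, `E_{A,B}` has multiplicative reduction at `p`
> if and only if `p ∣ Δ(A,B)` but `p ∤ A` [Sil]. These are just congruence conditions modulo `p`, and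
> so `S₀(p)` is a large family. If `p = 5`, then these conditions together amount to `5 ∤ A`."

This file PROVES the reduction-type sentences of this passage (everything except the ordinarity
sentence, which is Silverman V.4.1(a) and is treated in the sibling `LeadingTermBSZOrdinaryProofs`),
in the tree's vocabulary of `Literature/NumberTheory/DiophantineGeometry/LocalReduction.lean`
(place-indexed `IsMinimalAt`, `HasGoodReductionAt`, `HasMultiplicativeReductionAt`,
`HasAdditiveReductionAt` over `v : HeightOneSpectrum ℤ`) and of `Tamagawa.lean` (prime-indexed
`HasGoodReductionAtPrime`, `HasMultiplicativeReductionAtPrime`, the vocabulary of the rank-`0`/`1`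
criteria bsd.S30-style in which Theorems 5 and 9 of the source are phrased):

* `isMinimalAt_shortWeierstrass` — for `p ≥ 5` and `¬ (p⁴ ∣ A ∧ p⁶ ∣ B)`, `E_{A,B}` is minimal at
  `p` ("It follows from [Sil] …": Silverman, *AEC* VII.1 Remark 1.1, both halves — `ord_p(c₄) < 4`
  when `p⁴ ∤ A`, since `c₄ = -48A`; `ord_p(Δ) < 12` when `p⁴ ∣ A`, `p⁶ ∤ B`, since
  `Δ = -16(4A³ + 27B²)`);
* `hasGoodReductionAt_shortWeierstrass_iff` — good reduction at `p` iff `p ∤ 4A³ + 27B²`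
  (`Δ(A,B) = -16(4A³+27B²)` and `p ≠ 2`; *AEC* VII.5 Prop. 5.1(a));
* `hasMultiplicativeReductionAt_shortWeierstrass_iff` — multiplicative reduction at `p` iff
  `p ∣ 4A³ + 27B²` and `p ∤ A` (*AEC* VII.5 Prop. 5.1(b): `ord_p(c₄) = 0`, `c₄ = -48A`, `p ∤ 48`);
* `hasAdditiveReductionAt_shortWeierstrass_iff` — additive reduction at `p` iff `p ∣ 4A³ + 27B²`
  and `p ∣ A` (*AEC* VII.5 Prop. 5.1(c));
* `hasGoodReductionAtPrime_shortWeierstrass_iff`, `hasMultiplicativeReductionAtPrime_shortWeierstrass_iff`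
  — the same in the prime-indexed vocabulary (through the tree's bridges
  `hasGoodReductionAtPrime_primesEquiv_iff_hasGoodReductionAt`,
  `hasMultiplicativeReductionAtPrime_primesEquiv_iff_hasMultiplicativeReductionAt` of `RootNumberProofs`),
  and `…_of_isInHeightFamily` corollaries for members of the height family;
* `hasGoodReductionAtPrime_or_hasMultiplicativeReductionAtPrime_shortWeierstrass_iff` — hence, for
  a member of the family and `p ≥ 5`: good-or-multiplicative (semistable) reduction at `p` iff
  `¬ (p ∣ 4A³ + 27B² ∧ p ∣ A)`; with the ordinarity sentence (`p ∣ a_p ↔ p ∣ 2A` at `p = 5` in the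
  good case) this is the source's "these conditions together amount to `5 ∤ A`".

Everything is proved from the tree's local-reduction API (`isMinimalAt_of_lt_valuation_c₄`,
`isMinimalAt_baseChange_int_of_not_pow_dvd_Δ`, `hasGoodReductionAt_iff_of_isMinimalAt`,
`hasMultiplicativeReductionAt_iff_of_isMinimalAt`, `hasAdditiveReductionAt_iff_of_isMinimalAt`,
`Rat.valuation_intCast_…_iff`); no definitions and no named facts are introduced (D-0026).

## References

* M. Bhargava, C. Skinner, W. Zhang, arXiv:1407.1826 (2014), §3.1 (definition of `S₀(p)`) and
  Lemma 17 with its proof (p. 8). [cite: BhargavaSkinnerZhang2014, Lemma 17 (proof)]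
* J. H. Silverman, *The Arithmetic of Elliptic Curves*, GTM 106, 2nd ed. (2009), VII.1 Remark 1.1
  (minimality criteria `ord(Δ) < 12` or `ord(c₄) < 4`), VII.5 Prop. 5.1 (reduction types from
  `ord(Δ)`, `ord(c₄)` of a minimal equation), III.1 (`c₄ = -48A`, `Δ = -16(4A³+27B²)` for
  `y² = x³ + Ax + B`). [cite: SilvermanAEC2009, VII.1 Remark 1.1 and VII.5 Prop. 5.1]
-/

open IsDedekindDomain WeierstrassCurve Rat.HeightOneSpectrum

namespace Literature.NumberTheory.EllipticCurves

namespace BSZLemma17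

/-! ### The integral model `[0, 0, 0, A, B]` and its invariants -/

/-- `E_{A,B}` (the tree's `shortWeierstrass`) is the base change to `ℚ` of the `ℤ`-model
`[0, 0, 0, A, B]`. [folklore] -/
theorem shortWeierstrass_eq_baseChange (AB : ℤ × ℤ) :
    shortWeierstrass AB = (⟨0, 0, 0, AB.1, AB.2⟩ : WeierstrassCurve ℤ).baseChange ℚ := by
  ext <;> simp [shortWeierstrass, WeierstrassCurve.baseChange, WeierstrassCurve.map]

/-- `c₄ = -48A` for `y² = x³ + Ax + B` (Silverman, *AEC* III.1). [cite: SilvermanAEC2009, III.1] -/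
theorem int_c₄ (A B : ℤ) : (⟨0, 0, 0, A, B⟩ : WeierstrassCurve ℤ).c₄ = -48 * A := by
  simp only [WeierstrassCurve.c₄, WeierstrassCurve.b₂, WeierstrassCurve.b₄]; ring

/-- `Δ = -16(4A³ + 27B²)` for `y² = x³ + Ax + B` (Silverman, *AEC* III.1). [cite: SilvermanAEC2009, III.1] -/
theorem int_Δ (A B : ℤ) :
    (⟨0, 0, 0, A, B⟩ : WeierstrassCurve ℤ).Δ = -16 * (4 * A ^ 3 + 27 * B ^ 2) := by
  simp only [WeierstrassCurve.Δ, WeierstrassCurve.b₂, WeierstrassCurve.b₄, WeierstrassCurve.b₆,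
    WeierstrassCurve.b₈]; ring

/-- `E_{A,B}` with `4A³ + 27B² ≠ 0` is an elliptic curve (`Δ = -16(4A³+27B²) ≠ 0`). [folklore] -/
theorem isElliptic_of_ne_zero {AB : ℤ × ℤ} (h : 4 * AB.1 ^ 3 + 27 * AB.2 ^ 2 ≠ 0) :
    (shortWeierstrass AB).IsElliptic := by
  refine ⟨Ne.isUnit ?_⟩
  rw [shortWeierstrass_eq_baseChange, baseChange_int_Δ, int_Δ]
  exact_mod_cast mul_ne_zero (by norm_num) h

/-! ### Arithmetic of a prime `p ≥ 5` against the constants `16`, `27`, `48` -/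

/-- A prime `p ≥ 5` does not divide `2`. [folklore] -/
theorem not_dvd_two {p : ℕ} (hp : p.Prime) (h5 : 5 ≤ p) : ¬ p ∣ 2 := fun h ↦ by
  have := (Nat.prime_dvd_prime_iff_eq hp Nat.prime_two).mp h; omega

/-- A prime `p ≥ 5` does not divide `3`. [folklore] -/
theorem not_dvd_three {p : ℕ} (hp : p.Prime) (h5 : 5 ≤ p) : ¬ p ∣ 3 := fun h ↦ by
  have := (Nat.prime_dvd_prime_iff_eq hp Nat.prime_three).mp h; omega

/-- A prime `p ≥ 5` is coprime to `2^a 3^b`. [folklore] -/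
theorem coprime_two_pow_mul_three_pow {p : ℕ} (hp : p.Prime) (h5 : 5 ≤ p) (a b : ℕ) :
    p.Coprime (2 ^ a * 3 ^ b) :=
  Nat.Coprime.mul_right (Nat.Coprime.pow_right a ((Nat.coprime_primes hp Nat.prime_two).mpr
      (fun h ↦ not_dvd_two hp h5 (h ▸ dvd_rfl))))
    (Nat.Coprime.pow_right b ((Nat.coprime_primes hp Nat.prime_three).mpr
      (fun h ↦ not_dvd_three hp h5 (h ▸ dvd_rfl))))

/-- For a prime `p ≥ 5`, `k ≥ 0` and `n = 2^a 3^b`: `p^k ∣ n·m → p^k ∣ m` in `ℤ`. [folklore] -/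
theorem pow_dvd_of_pow_dvd_mul {p : ℕ} (hp : p.Prime) (h5 : 5 ≤ p) (k a b : ℕ) {m : ℤ}
    (h : (p : ℤ) ^ k ∣ (2 : ℤ) ^ a * 3 ^ b * m) : (p : ℤ) ^ k ∣ m := by
  have hc : IsCoprime ((p : ℤ) ^ k) ((2 : ℤ) ^ a * 3 ^ b) := by
    have := (Nat.isCoprime_iff_coprime.mpr ((coprime_two_pow_mul_three_pow hp h5 a b).pow_left k))
    exact_mod_cast this
  exact hc.dvd_of_dvd_mul_left h

/-- For a prime `p ≥ 5`: `p ∣ -48A ↔ p ∣ A`. [folklore] -/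
theorem dvd_c₄_iff {p : ℕ} (hp : p.Prime) (h5 : 5 ≤ p) (A : ℤ) :
    (p : ℤ) ∣ -48 * A ↔ (p : ℤ) ∣ A := by
  refine ⟨fun h ↦ ?_, fun h ↦ h.mul_left _⟩
  have h' : (p : ℤ) ^ 1 ∣ (2 : ℤ) ^ 4 * 3 ^ 1 * (-A) := by
    rw [pow_one]; convert h using 1; ring
  simpa using pow_dvd_of_pow_dvd_mul hp h5 1 4 1 h'

/-- For a prime `p ≥ 5`: `p⁴ ∣ -48A → p⁴ ∣ A`. [folklore] -/
theorem pow_four_dvd_of_dvd_c₄ {p : ℕ} (hp : p.Prime) (h5 : 5 ≤ p) {A : ℤ}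
    (h : (p : ℤ) ^ 4 ∣ -48 * A) : (p : ℤ) ^ 4 ∣ A := by
  have h' : (p : ℤ) ^ 4 ∣ (2 : ℤ) ^ 4 * 3 ^ 1 * (-A) := by convert h using 1; ring
  simpa using pow_dvd_of_pow_dvd_mul hp h5 4 4 1 h'

/-- For a prime `p ≥ 5`: `p ∣ -16(4A³ + 27B²) ↔ p ∣ 4A³ + 27B²`. [folklore] -/
theorem dvd_Δ_iff {p : ℕ} (hp : p.Prime) (h5 : 5 ≤ p) (A B : ℤ) :
    (p : ℤ) ∣ -16 * (4 * A ^ 3 + 27 * B ^ 2) ↔ (p : ℤ) ∣ 4 * A ^ 3 + 27 * B ^ 2 := by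
  refine ⟨fun h ↦ ?_, fun h ↦ h.mul_left _⟩
  have h' : (p : ℤ) ^ 1 ∣ (2 : ℤ) ^ 4 * 3 ^ 0 * (-(4 * A ^ 3 + 27 * B ^ 2)) := by
    rw [pow_one]; convert h using 1; ring
  have h'' := pow_dvd_of_pow_dvd_mul hp h5 1 4 0 h'
  rwa [pow_one, dvd_neg] at h''

/-- For a prime `p ≥ 5`: if `p⁴ ∣ A` and `p¹² ∣ -16(4A³ + 27B²)` then `p⁶ ∣ B`
(`p¹² ∣ 4A³`, so `p¹² ∣ 27B²`, so `p¹² ∣ B²`). [folklore] -/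
theorem pow_six_dvd_of_pow_twelve_dvd_Δ {p : ℕ} (hp : p.Prime) (h5 : 5 ≤ p) {A B : ℤ}
    (hA : (p : ℤ) ^ 4 ∣ A) (h : (p : ℤ) ^ 12 ∣ -16 * (4 * A ^ 3 + 27 * B ^ 2)) :
    (p : ℤ) ^ 6 ∣ B := by
  have h1 : (p : ℤ) ^ 12 ∣ 4 * A ^ 3 + 27 * B ^ 2 := by
    have h' : (p : ℤ) ^ 12 ∣ (2 : ℤ) ^ 4 * 3 ^ 0 * (-(4 * A ^ 3 + 27 * B ^ 2)) := by
      convert h using 1; ring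
    have h'' := pow_dvd_of_pow_dvd_mul hp h5 12 4 0 h'
    rwa [dvd_neg] at h''
  have h2 : (p : ℤ) ^ 12 ∣ 4 * A ^ 3 := by
    obtain ⟨a, rfl⟩ := hA
    exact ⟨4 * a ^ 3, by ring⟩
  have h3 : (p : ℤ) ^ 12 ∣ 27 * B ^ 2 := by
    have := dvd_sub h1 h2
    rwa [add_sub_cancel_left] at this
  have h4 : (p : ℤ) ^ 12 ∣ B ^ 2 := by
    have h' : (p : ℤ) ^ 12 ∣ (2 : ℤ) ^ 0 * 3 ^ 3 * B ^ 2 := by convert h3 using 1; ring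
    exact pow_dvd_of_pow_dvd_mul hp h5 12 0 3 h'
  rw [show (12 : ℕ) = 6 * 2 from rfl, pow_mul] at h4
  exact (Int.pow_dvd_pow_iff two_ne_zero).mp h4

end BSZLemma17

open BSZLemma17

/-! ### Minimality of `E_{A,B}` at `p ≥ 5` (BSZ: "It follows from [Sil] that `E_{A,B}` is a
minimal Weierstrass equation at `p`") -/

section PlaceIndexed

variable (v : HeightOneSpectrum ℤ)

/-- **`E_{A,B}` is minimal at every prime `p ≥ 5`** when `¬ (p⁴ ∣ A ∧ p⁶ ∣ B)` (in particular for
every member of the height family): if `p⁴ ∤ A` then `ord_p(c₄) = ord_p(-48A) < 4`; otherwise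
`p⁶ ∤ B` and `ord_p(Δ) = ord_p(-16(4A³ + 27B²)) < 12` — Silverman's two criteria, *AEC* VII.1
Remark 1.1, as invoked in the proof of Lemma 17 of the source ("It follows from [Sil] that `E_{A,B}`
is a minimal Weierstrass equation at `p`"). Here `p = natGenerator v` is the prime below the finite
place `v` of `ℤ`. [cite: BhargavaSkinnerZhang2014, Lemma 17 (proof)] -/
theorem isMinimalAt_shortWeierstrass {AB : ℤ × ℤ} (h5 : 5 ≤ natGenerator v)
    (hfam : ¬ ((natGenerator v : ℤ) ^ 4 ∣ AB.1 ∧ (natGenerator v : ℤ) ^ 6 ∣ AB.2)) :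
    (shortWeierstrass AB).IsMinimalAt v := by
  have hp : (natGenerator v).Prime := prime_natGenerator v
  rw [shortWeierstrass_eq_baseChange]
  by_cases hA : (natGenerator v : ℤ) ^ 4 ∣ AB.1
  · have hB : ¬ (natGenerator v : ℤ) ^ 6 ∣ AB.2 := fun hB ↦ hfam ⟨hA, hB⟩
    refine isMinimalAt_baseChange_int_of_not_pow_dvd_Δ fun hΔ ↦ hB ?_
    rw [int_Δ] at hΔ
    exact pow_six_dvd_of_pow_twelve_dvd_Δ hp h5 hA hΔ
  · refine isMinimalAt_of_lt_valuation_c₄ (isIntegralAt_baseChange_int v _) ?_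
    rw [baseChange_int_c₄, int_c₄]
    have h := (Rat.exp_lt_valuation_intCast_iff v (-48 * AB.1) 4).mpr
      fun h ↦ hA (pow_four_dvd_of_dvd_c₄ hp h5 h)
    simpa using h

/-! ### Reduction types of `E_{A,B}` at `p ≥ 5` read off `(A, B)` -/

/-- **Good reduction: `E_{A,B}` has good reduction at `p ≥ 5` iff `p ∤ 4A³ + 27B²`** (for
`¬ (p⁴ ∣ A ∧ p⁶ ∣ B)`; the source: "`E_{A,B}` has good reduction at `p` if and only if
`p ∤ Δ(A,B)`", `Δ(A,B) = -16(4A³+27B²)`; Silverman *AEC* VII.5 Prop. 5.1(a) on the minimal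
equation `E_{A,B}`). [cite: BhargavaSkinnerZhang2014, Lemma 17 (proof)] -/
theorem hasGoodReductionAt_shortWeierstrass_iff {AB : ℤ × ℤ} (h5 : 5 ≤ natGenerator v)
    (hfam : ¬ ((natGenerator v : ℤ) ^ 4 ∣ AB.1 ∧ (natGenerator v : ℤ) ^ 6 ∣ AB.2)) :
    (shortWeierstrass AB).HasGoodReductionAt v ↔
      ¬ (natGenerator v : ℤ) ∣ 4 * AB.1 ^ 3 + 27 * AB.2 ^ 2 := by
  rw [hasGoodReductionAt_iff_of_isMinimalAt (isMinimalAt_shortWeierstrass v h5 hfam),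
    shortWeierstrass_eq_baseChange, baseChange_int_Δ, int_Δ, Rat.valuation_intCast_eq_one_iff,
    dvd_Δ_iff (prime_natGenerator v) h5]

/-- **Multiplicative reduction: `E_{A,B}` has multiplicative reduction at `p ≥ 5` iff
`p ∣ 4A³ + 27B²` and `p ∤ A`** (for `4A³ + 27B² ≠ 0` and `¬ (p⁴ ∣ A ∧ p⁶ ∣ B)`; the source:
"`E_{A,B}` has multiplicative reduction at `p` if and only if `p ∣ Δ(A,B)` but `p ∤ A`"; Silverman
*AEC* VII.5 Prop. 5.1(b) on the minimal equation `E_{A,B}`, `c₄ = -48A`, `p ∤ 48`).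
[cite: BhargavaSkinnerZhang2014, Lemma 17 (proof)] -/
theorem hasMultiplicativeReductionAt_shortWeierstrass_iff {AB : ℤ × ℤ} (h5 : 5 ≤ natGenerator v)
    (hΔ : 4 * AB.1 ^ 3 + 27 * AB.2 ^ 2 ≠ 0)
    (hfam : ¬ ((natGenerator v : ℤ) ^ 4 ∣ AB.1 ∧ (natGenerator v : ℤ) ^ 6 ∣ AB.2)) :
    (shortWeierstrass AB).HasMultiplicativeReductionAt v ↔
      (natGenerator v : ℤ) ∣ 4 * AB.1 ^ 3 + 27 * AB.2 ^ 2 ∧ ¬ (natGenerator v : ℤ) ∣ AB.1 := by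
  haveI := isElliptic_of_ne_zero hΔ
  rw [hasMultiplicativeReductionAt_iff_of_isMinimalAt (isMinimalAt_shortWeierstrass v h5 hfam),
    shortWeierstrass_eq_baseChange, baseChange_int_Δ, baseChange_int_c₄, int_Δ, int_c₄,
    Rat.valuation_intCast_lt_one_iff, Rat.valuation_intCast_eq_one_iff,
    dvd_Δ_iff (prime_natGenerator v) h5, dvd_c₄_iff (prime_natGenerator v) h5]

/-- **Additive reduction: `E_{A,B}` has additive reduction at `p ≥ 5` iff `p ∣ 4A³ + 27B²` and
`p ∣ A`** (for `4A³ + 27B² ≠ 0` and `¬ (p⁴ ∣ A ∧ p⁶ ∣ B)`; Silverman *AEC* VII.5 Prop. 5.1(c) on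
the minimal equation `E_{A,B}`; the complement of `S₀(p)` among curves of bad reduction at `p`).
[cite: SilvermanAEC2009, VII.5 Prop. 5.1(c)] -/
theorem hasAdditiveReductionAt_shortWeierstrass_iff {AB : ℤ × ℤ} (h5 : 5 ≤ natGenerator v)
    (hΔ : 4 * AB.1 ^ 3 + 27 * AB.2 ^ 2 ≠ 0)
    (hfam : ¬ ((natGenerator v : ℤ) ^ 4 ∣ AB.1 ∧ (natGenerator v : ℤ) ^ 6 ∣ AB.2)) :
    (shortWeierstrass AB).HasAdditiveReductionAt v ↔
      (natGenerator v : ℤ) ∣ 4 * AB.1 ^ 3 + 27 * AB.2 ^ 2 ∧ (natGenerator v : ℤ) ∣ AB.1 := by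
  haveI := isElliptic_of_ne_zero hΔ
  rw [hasAdditiveReductionAt_iff_of_isMinimalAt (isMinimalAt_shortWeierstrass v h5 hfam),
    shortWeierstrass_eq_baseChange, baseChange_int_Δ, baseChange_int_c₄, int_Δ, int_c₄,
    Rat.valuation_intCast_lt_one_iff, Rat.valuation_intCast_lt_one_iff,
    dvd_Δ_iff (prime_natGenerator v) h5, dvd_c₄_iff (prime_natGenerator v) h5]

/-- Semistable (good or multiplicative) reduction of `E_{A,B}` at `p ≥ 5` iff
`¬ (p ∣ 4A³ + 27B² ∧ p ∣ A)` — the reduction-type part of the source's description of `S₀(p)`.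
[cite: BhargavaSkinnerZhang2014, Lemma 17 (proof)] -/
theorem isSemistableAt_shortWeierstrass_iff {AB : ℤ × ℤ} (h5 : 5 ≤ natGenerator v)
    (hΔ : 4 * AB.1 ^ 3 + 27 * AB.2 ^ 2 ≠ 0)
    (hfam : ¬ ((natGenerator v : ℤ) ^ 4 ∣ AB.1 ∧ (natGenerator v : ℤ) ^ 6 ∣ AB.2)) :
    (shortWeierstrass AB).IsSemistableAt v ↔
      ¬ ((natGenerator v : ℤ) ∣ 4 * AB.1 ^ 3 + 27 * AB.2 ^ 2 ∧ (natGenerator v : ℤ) ∣ AB.1) := by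
  haveI := isElliptic_of_ne_zero hΔ
  rw [isSemistableAt_iff_not_hasAdditiveReductionAt,
    hasAdditiveReductionAt_shortWeierstrass_iff v h5 hΔ hfam]

end PlaceIndexed

/-! ### Prime-indexed form (the vocabulary of `Tamagawa.lean`, bsd.S30 and Theorems 5, 9 of the
source) -/

section PrimeIndexed

variable {AB : ℤ × ℤ} (p : ℕ) [hp : Fact p.Prime]

/-- **`E_{A,B}` has good reduction at the prime `p ≥ 5` iff `p ∤ 4A³ + 27B²`** (prime-indexed
`HasGoodReductionAtPrime`; for `¬ (p⁴ ∣ A ∧ p⁶ ∣ B)`). [cite: BhargavaSkinnerZhang2014, Lemma 17 (proof)] -/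
theorem hasGoodReductionAtPrime_shortWeierstrass_iff (h5 : 5 ≤ p)
    (hfam : ¬ ((p : ℤ) ^ 4 ∣ AB.1 ∧ (p : ℤ) ^ 6 ∣ AB.2)) :
    (shortWeierstrass AB).HasGoodReductionAtPrime p ↔ ¬ (p : ℤ) ∣ 4 * AB.1 ^ 3 + 27 * AB.2 ^ 2 := by
  obtain ⟨v, rfl⟩ : ∃ v : HeightOneSpectrum ℤ, (primesEquiv v : ℕ) = p :=
    ⟨primesEquiv.symm ⟨p, hp.out⟩, by rw [Equiv.apply_symm_apply]⟩
  rw [hasGoodReductionAtPrime_primesEquiv_iff_hasGoodReductionAt (shortWeierstrass AB) v]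
  exact hasGoodReductionAt_shortWeierstrass_iff v h5 hfam

/-- **`E_{A,B}` has multiplicative reduction at the prime `p ≥ 5` iff `p ∣ 4A³ + 27B²` and
`p ∤ A`** (prime-indexed `HasMultiplicativeReductionAtPrime`; for `4A³ + 27B² ≠ 0` and
`¬ (p⁴ ∣ A ∧ p⁶ ∣ B)`). [cite: BhargavaSkinnerZhang2014, Lemma 17 (proof)] -/
theorem hasMultiplicativeReductionAtPrime_shortWeierstrass_iff (h5 : 5 ≤ p)
    (hΔ : 4 * AB.1 ^ 3 + 27 * AB.2 ^ 2 ≠ 0) (hfam : ¬ ((p : ℤ) ^ 4 ∣ AB.1 ∧ (p : ℤ) ^ 6 ∣ AB.2)) :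
    (shortWeierstrass AB).HasMultiplicativeReductionAtPrime p ↔
      (p : ℤ) ∣ 4 * AB.1 ^ 3 + 27 * AB.2 ^ 2 ∧ ¬ (p : ℤ) ∣ AB.1 := by
  haveI := isElliptic_of_ne_zero hΔ
  obtain ⟨v, rfl⟩ : ∃ v : HeightOneSpectrum ℤ, (primesEquiv v : ℕ) = p :=
    ⟨primesEquiv.symm ⟨p, hp.out⟩, by rw [Equiv.apply_symm_apply]⟩
  rw [hasMultiplicativeReductionAtPrime_primesEquiv_iff_hasMultiplicativeReductionAt
    (shortWeierstrass AB) v]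
  exact hasMultiplicativeReductionAt_shortWeierstrass_iff v h5 hΔ hfam

/-- **The reduction-type half of `S₀(p)`**: for `4A³ + 27B² ≠ 0`, `¬ (p⁴ ∣ A ∧ p⁶ ∣ B)` and a
prime `p ≥ 5`, `E_{A,B}` has good or multiplicative reduction at `p` iff
`¬ (p ∣ 4A³ + 27B² ∧ p ∣ A)`; at `p = 5`, together with the ordinarity criterion in the good case,
"these conditions together amount to `5 ∤ A`". [cite: BhargavaSkinnerZhang2014, Lemma 17 (proof)] -/
theorem hasGoodReductionAtPrime_or_hasMultiplicativeReductionAtPrime_shortWeierstrass_iff (h5 : 5 ≤ p)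
    (hΔ : 4 * AB.1 ^ 3 + 27 * AB.2 ^ 2 ≠ 0) (hfam : ¬ ((p : ℤ) ^ 4 ∣ AB.1 ∧ (p : ℤ) ^ 6 ∣ AB.2)) :
    (shortWeierstrass AB).HasGoodReductionAtPrime p ∨
        (shortWeierstrass AB).HasMultiplicativeReductionAtPrime p ↔
      ¬ ((p : ℤ) ∣ 4 * AB.1 ^ 3 + 27 * AB.2 ^ 2 ∧ (p : ℤ) ∣ AB.1) := by
  rw [hasGoodReductionAtPrime_shortWeierstrass_iff p h5 hfam,
    hasMultiplicativeReductionAtPrime_shortWeierstrass_iff p h5 hΔ hfam]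
  tauto

/-! ### Members of the height family -/

/-- For `(A, B)` in the height family and a prime `p ≥ 5`: `E_{A,B}` has good reduction at `p` iff
`p ∤ 4A³ + 27B²`. [cite: BhargavaSkinnerZhang2014, Lemma 17 (proof)] -/
theorem hasGoodReductionAtPrime_shortWeierstrass_iff_of_isInHeightFamily (h : IsInHeightFamily AB)
    (h5 : 5 ≤ p) :
    (shortWeierstrass AB).HasGoodReductionAtPrime p ↔ ¬ (p : ℤ) ∣ 4 * AB.1 ^ 3 + 27 * AB.2 ^ 2 :=
  hasGoodReductionAtPrime_shortWeierstrass_iff p h5 (h.2 p hp.out)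

/-- For `(A, B)` in the height family and a prime `p ≥ 5`: `E_{A,B}` has multiplicative reduction
at `p` iff `p ∣ 4A³ + 27B²` and `p ∤ A`. [cite: BhargavaSkinnerZhang2014, Lemma 17 (proof)] -/
theorem hasMultiplicativeReductionAtPrime_shortWeierstrass_iff_of_isInHeightFamily
    (h : IsInHeightFamily AB) (h5 : 5 ≤ p) :
    (shortWeierstrass AB).HasMultiplicativeReductionAtPrime p ↔
      (p : ℤ) ∣ 4 * AB.1 ^ 3 + 27 * AB.2 ^ 2 ∧ ¬ (p : ℤ) ∣ AB.1 :=
  hasMultiplicativeReductionAtPrime_shortWeierstrass_iff p h5 h.1 (h.2 p hp.out)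

/-- For `(A, B)` in the height family and a prime `p ≥ 5`: `E_{A,B}` has good or multiplicative
reduction at `p` iff `¬ (p ∣ 4A³ + 27B² ∧ p ∣ A)`; in particular `p ∤ A` suffices (the case
`p = 5` is the reduction-type half of "`S₀(5)` = {`5 ∤ A`}"). [cite: BhargavaSkinnerZhang2014, Lemma 17 (proof)] -/
theorem hasGoodReductionAtPrime_or_hasMultiplicativeReductionAtPrime_of_not_dvd
    (h : IsInHeightFamily AB) (h5 : 5 ≤ p) (hA : ¬ (p : ℤ) ∣ AB.1) :
    (shortWeierstrass AB).HasGoodReductionAtPrime p ∨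
      (shortWeierstrass AB).HasMultiplicativeReductionAtPrime p :=
  (hasGoodReductionAtPrime_or_hasMultiplicativeReductionAtPrime_shortWeierstrass_iff p h5 h.1
    (h.2 p hp.out)).mpr fun h' ↦ hA h'.2

/-- Conversely, multiplicative reduction of a family member at `p ≥ 5` forces `p ∤ A`.
[cite: BhargavaSkinnerZhang2014, Lemma 17 (proof)] -/
theorem not_dvd_of_hasMultiplicativeReductionAtPrime (h : IsInHeightFamily AB) (h5 : 5 ≤ p)
    (hm : (shortWeierstrass AB).HasMultiplicativeReductionAtPrime p) : ¬ (p : ℤ) ∣ AB.1 :=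
  ((hasMultiplicativeReductionAtPrime_shortWeierstrass_iff_of_isInHeightFamily p h h5).mp hm).2

end PrimeIndexed

end Literature.NumberTheory.EllipticCurves
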